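import Literature.Barriers.ResolutionOfSingularities.ResidualOrderUnboundedExample1
import HarnessLib

/-!
# Hauser–Perlega's first example: iterating the cycle, the residual order tends to infinity

`Literature/Barriers/ResolutionOfSingularities/ResidualOrderUnboundedExample1Cycle.lean` — assembly
of the stages of `ResidualOrderUnboundedExample1.lean` into the infinite point blow-up sequence of
Hauser–Perlega's FIRST EXAMPLE [cite: HauserPerlega2019, §4]: starting from
`F⁰ = x⁴y⁴w⁶(w² + x³u¹⁰)` (the starting equation (0) with `d = 2`, `a = b = r = 0`, `s = 1`,
`λ = 1`, `Q = 0`, `A = 1`), cycle `m` (with `d = 2m + 2`) consists of the `5d/2 + 15 = 5m + 20`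
point blow-ups (1), (2), (3), (4)×`(d/2)`, (5), (6), (7)×`(2d+10)`, the roles of `y` and `u`
being exchanged after each cycle ("exchanging `y` with `u` and `b` with `r`"). Along the whole
sequence the order of `f = z⁸ + F` stays `8` and the residual order is `≥ d = 2m + 2` during
cycle `m`, whence "Since the sequence of blowups can be iterated indefinitely, the residual order
also increases indefinitely" [cite: HauserPerlega2019, §4]: `hasDivergentPointBlowupSequence_two`,
the first conjunct of the named fact `HauserPerlega2019` — for EVERY field of characteristic `2`
(algebraic closedness is not needed for this example).
-/

noncomputable section

open MvPolynomial Finset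

open scoped BigOperators

namespace Literature.Barriers.ResolutionOfSingularities

open Literature.AlgebraicGeometry.Resolution.Hauser2010

namespace HauserPerlega

namespace Example1

/-! ## The schedule of charts -/

/-- `d = 2m + 2` during cycle `m` (we start with `d = 2`). [cite: HauserPerlega2019, §4 First example] -/
def dOf (m : ℕ) : ℕ := 2 * m + 2

/-- Number of point blow-ups in cycle `m`: `3 + d/2 + 2 + (2d + 10) = 5m + 20`.
[cite: HauserPerlega2019, §4 First example] -/
def len (m : ℕ) : ℕ := 5 * m + 20

/-- The chart (variable `j`, translated variables `T`) of the `i`-th blow-up of cycle `m`, in the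
roles of cycle `0`: (1) `x`-chart `y ↦ y+1, u ↦ u+1`; (2) `x`-chart; (3) `u`-chart; (4) `d/2` times
`v`-chart; (5) `w`-chart `y ↦ y+1, v ↦ v+1`; (6) `u`-chart; (7) `2d+10` times `y`-chart.
[cite: HauserPerlega2019, §4 First example (1)–(7)] -/
def chartAt (m i : ℕ) : Fin 5 × Finset (Fin 5) :=
  if i = 0 then (0, {1, 2}) else if i = 1 then (0, ∅) else if i = 2 then (2, ∅)
  else if i ≤ m + 3 then (3, ∅) else if i = m + 4 then (4, {1, 3}) else if i = m + 5 then (2, ∅)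
  else (1, ∅)

/-- Position `(cycle, index in cycle)` of the `k`-th blow-up. [folklore] -/
def pos : ℕ → ℕ × ℕ
  | 0 => (0, 0)
  | k + 1 => if (pos k).2 + 1 < len (pos k).1 then ((pos k).1, (pos k).2 + 1) else ((pos k).1 + 1, 0)

/-- The recursion of `pos`. [folklore] -/
theorem pos_succ (k : ℕ) : pos (k + 1) =
    if (pos k).2 + 1 < len (pos k).1 then ((pos k).1, (pos k).2 + 1) else ((pos k).1 + 1, 0) := rfl

/-- The exchange of `y` and `u` accumulated before cycle `m`. [cite: HauserPerlega2019, §4 First example] -/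
def sw (m : ℕ) : Equiv.Perm (Fin 5) := Equiv.swap 1 2 ^ m

/-- `sw (m+1) = swap ∘ sw m`. [folklore] -/
theorem sw_succ (m : ℕ) : sw (m + 1) = Equiv.swap 1 2 * sw m := by
  rw [sw, pow_succ', sw]

variable (K : Type*) [CommRing K]

/-- The chart variable of the `k`-th blow-up (actual variables). [cite: HauserPerlega2019, §4] -/
def jSched (k : ℕ) : Fin 5 := (sw (pos k).1).symm (chartAt (pos k).1 (pos k).2).1

/-- The translations of the `k`-th blow-up (actual variables). [cite: HauserPerlega2019, §4] -/
def tSched (k : ℕ) : Fin 5 → K := tOf (chartAt (pos k).1 (pos k).2).2 ∘ sw (pos k).1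

/-- The starting polynomial `F⁰ = x⁴y⁴w⁸ + x⁷y⁴u¹⁰w⁶ = x⁴y⁴w⁶·(w² + x³u¹⁰)`: the starting equation
(0) with `d = 2`, `a = b = r = 0`, `s = 1`, `λ = 1`, `Q = 0`, `A = 1`.
[cite: HauserPerlega2019, §4 First example (0)] -/
def F0 : MvPolynomial (Fin 5) K := monomial (V 4 4 0 0 8) 1 + monomial (V 7 4 10 0 6) 1

/-- The sequence `F^k` of the first example. [cite: HauserPerlega2019, §4 First example] -/
def seq : ℕ → MvPolynomial (Fin 5) K := seqF 8 jSched (tSched K) (F0 K)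

variable {K}

/-- Coefficients of `F⁰`. [folklore] -/
theorem coeff_F0 [Nontrivial K] (e : Fin 5 →₀ ℕ) :
    coeff e (F0 K) = (if V 4 4 0 0 8 = e then 1 else 0) + (if V 7 4 10 0 6 = e then 1 else 0) := by
  simp only [F0, coeff_add, coeff_monomial]

/-- `F⁰` has shape (0) with `d = 2`, `(ex, ey, eu, ew) = (4, 4, 0, 6)`. [cite: HauserPerlega2019, §4 First example (0)] -/
theorem shape0_F0 [Nontrivial K] : Shape0 2 4 4 0 6 (F0 K) := by
  refine ⟨?_, ?_, ?_⟩
  · intro e he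
    rw [MvPolynomial.mem_support_iff, coeff_F0] at he
    by_cases h1 : V 4 4 0 0 8 = e
    · exact Or.inl h1.symm
    by_cases h2 : V 7 4 10 0 6 = e
    · subst h2; right; right; simp
    simp [h1, h2] at he
  · rw [coeff_F0]; simp [eq_V_iff]
  · rw [coeff_F0]; simp [eq_V_iff]

/-- `F⁰` is clean (no `8`-th power monomials). [cite: HauserPerlega2019, §4 First example (0)] -/
theorem isClean_F0 [Nontrivial K] : IsClean 8 (F0 K) := by
  intro e he
  rw [MvPolynomial.mem_support_iff, coeff_F0] at he
  by_cases h1 : V 4 4 0 0 8 = e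
  · subst h1; rw [isPthPowerExponent_fin5_iff]; simp
  by_cases h2 : V 7 4 10 0 6 = e
  · subst h2; rw [isPthPowerExponent_fin5_iff]; simp
  simp [h1, h2] at he

/-- `F⁰ ≠ 0`. [folklore] -/
theorem F0_ne_zero [Nontrivial K] : F0 K ≠ 0 := by
  intro h
  have := (shape0_F0 (K := K)).2.1
  rw [h, coeff_zero] at this
  exact this rfl

/-! ## The state after the `k`-th blow-up -/

/-- The shape (with its arithmetic side conditions) of the polynomial at position `i` of cycle `m`,
in the roles of cycle `0`. [cite: HauserPerlega2019, §4 First example (0)–(7)] -/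
def StateShape (m i : ℕ) (G : MvPolynomial (Fin 5) K) : Prop :=
  if i = 0 then ∃ ex ey eu ew, ex % 8 = 4 ∧ ey % 8 = 4 ∧ eu % 8 = 0 ∧ (ew + dOf m) % 8 = 0 ∧
      Shape0 (dOf m) ex ey eu ew G
  else if i = 1 then ∃ ex ew, 8 ≤ ex ∧ ex % 8 = 0 ∧ (ew + dOf m) % 8 = 0 ∧ Shape1 (dOf m) ex ew G
  else if i = 2 then ∃ ex ew, ex % 8 = 4 ∧ (ew + dOf m) % 8 = 0 ∧ Shape2 (dOf m) ex ew G
  else if i ≤ m + 4 then ∃ ex eu ev ew, ex % 8 = 4 ∧ eu % 8 = 7 ∧ ev % 8 = (6 * (i - 3)) % 8 ∧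
      (ew + dOf m) % 8 = 0 ∧ Shape4 (i - 3) (dOf m) ex eu ev ew G
  else if i = m + 5 then ∃ ex eu ew, ex % 8 = 4 ∧ eu % 8 = 7 ∧ (ew + dOf m + 2) % 8 = 0 ∧
      Shape5 (dOf m) ex eu ew G
  else ∃ ex ey eu ew, ex % 8 = 4 ∧ ey % 8 = 0 ∧ eu % 8 = 4 ∧ (ew + dOf m + 2) % 8 = 0 ∧
      Shape7 (i - (m + 6)) (dOf m) ex ey eu ew G

/-- The state at position `0` of a cycle. [folklore] -/
theorem stateShape_zero {m : ℕ} {G : MvPolynomial (Fin 5) K} : StateShape m 0 G ↔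
    ∃ ex ey eu ew, ex % 8 = 4 ∧ ey % 8 = 4 ∧ eu % 8 = 0 ∧ (ew + dOf m) % 8 = 0 ∧
      Shape0 (dOf m) ex ey eu ew G := by
  unfold StateShape; rw [if_pos rfl]

/-- The state at position `1` of a cycle. [folklore] -/
theorem stateShape_one {m : ℕ} {G : MvPolynomial (Fin 5) K} : StateShape m 1 G ↔
    ∃ ex ew, 8 ≤ ex ∧ ex % 8 = 0 ∧ (ew + dOf m) % 8 = 0 ∧ Shape1 (dOf m) ex ew G := by
  unfold StateShape; rw [if_neg (by decide), if_pos rfl]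

/-- The state at position `2` of a cycle. [folklore] -/
theorem stateShape_two {m : ℕ} {G : MvPolynomial (Fin 5) K} : StateShape m 2 G ↔
    ∃ ex ew, ex % 8 = 4 ∧ (ew + dOf m) % 8 = 0 ∧ Shape2 (dOf m) ex ew G := by
  unfold StateShape; rw [if_neg (by decide), if_neg (by decide), if_pos rfl]

/-- The state at positions `3, …, m + 4` of cycle `m` (blow-ups (4)). [folklore] -/
theorem stateShape_four {m i : ℕ} (h3 : 3 ≤ i) (h4 : i ≤ m + 4) {G : MvPolynomial (Fin 5) K} :
    StateShape m i G ↔ ∃ ex eu ev ew, ex % 8 = 4 ∧ eu % 8 = 7 ∧ ev % 8 = (6 * (i - 3)) % 8 ∧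
      (ew + dOf m) % 8 = 0 ∧ Shape4 (i - 3) (dOf m) ex eu ev ew G := by
  unfold StateShape
  rw [if_neg (by omega), if_neg (by omega), if_neg (by omega), if_pos h4]

/-- The state at position `m + 5` of cycle `m`. [folklore] -/
theorem stateShape_five {m : ℕ} {G : MvPolynomial (Fin 5) K} : StateShape m (m + 5) G ↔
    ∃ ex eu ew, ex % 8 = 4 ∧ eu % 8 = 7 ∧ (ew + dOf m + 2) % 8 = 0 ∧ Shape5 (dOf m) ex eu ew G := by
  unfold StateShape
  rw [if_neg (by omega), if_neg (by omega), if_neg (by omega), if_neg (by omega), if_pos rfl]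

/-- The state at positions `≥ m + 6` of cycle `m` (blow-ups (7)). [folklore] -/
theorem stateShape_seven {m i : ℕ} (h6 : m + 6 ≤ i) {G : MvPolynomial (Fin 5) K} :
    StateShape m i G ↔ ∃ ex ey eu ew, ex % 8 = 4 ∧ ey % 8 = 0 ∧ eu % 8 = 4 ∧
      (ew + dOf m + 2) % 8 = 0 ∧ Shape7 (i - (m + 6)) (dOf m) ex ey eu ew G := by
  unfold StateShape
  rw [if_neg (by omega), if_neg (by omega), if_neg (by omega), if_neg (by omega), if_neg (by omega)]

/-- Chart of blow-up (1). [folklore] -/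
theorem chartAt_zero (m : ℕ) : chartAt m 0 = (0, {1, 2}) := by unfold chartAt; rw [if_pos rfl]
/-- Chart of blow-up (2). [folklore] -/
theorem chartAt_one (m : ℕ) : chartAt m 1 = (0, ∅) := by
  unfold chartAt; rw [if_neg (by decide), if_pos rfl]
/-- Chart of blow-up (3). [folklore] -/
theorem chartAt_two (m : ℕ) : chartAt m 2 = (2, ∅) := by
  unfold chartAt; rw [if_neg (by decide), if_neg (by decide), if_pos rfl]
/-- Chart of the blow-ups (4). [folklore] -/
theorem chartAt_four {m i : ℕ} (h3 : 3 ≤ i) (h4 : i ≤ m + 3) : chartAt m i = (3, ∅) := by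
  unfold chartAt; rw [if_neg (by omega), if_neg (by omega), if_neg (by omega), if_pos h4]
/-- Chart of blow-up (5). [folklore] -/
theorem chartAt_five (m : ℕ) : chartAt m (m + 4) = (4, {1, 3}) := by
  unfold chartAt
  rw [if_neg (by omega), if_neg (by omega), if_neg (by omega), if_neg (by omega), if_pos rfl]
/-- Chart of blow-up (6). [folklore] -/
theorem chartAt_six (m : ℕ) : chartAt m (m + 5) = (2, ∅) := by
  unfold chartAt
  rw [if_neg (by omega), if_neg (by omega), if_neg (by omega), if_neg (by omega), if_neg (by omega),
    if_pos rfl]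
/-- Chart of the blow-ups (7). [folklore] -/
theorem chartAt_seven {m i : ℕ} (h6 : m + 6 ≤ i) : chartAt m i = (1, ∅) := by
  unfold chartAt
  rw [if_neg (by omega), if_neg (by omega), if_neg (by omega), if_neg (by omega), if_neg (by omega),
    if_neg (by omega)]

/-- **One blow-up inside a cycle** preserves the state description. [cite: HauserPerlega2019, §4 First example] -/
theorem stateShape_step [CharP K 2] {m i : ℕ} (hi : i + 1 < len m) {G : MvPolynomial (Fin 5) K}
    (h : StateShape m i G) :
    StateShape m (i + 1) (blowupStep 8 (chartAt m i).1 (tOf (chartAt m i).2) G) := by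
  have hd : 2 ≤ dOf m := by unfold dOf; omega
  have hd2 : dOf m % 2 = 0 := by unfold dOf; omega
  unfold len at hi
  rcases Nat.lt_or_ge i 3 with h3 | h3
  · interval_cases i
    · -- blow-up (1)
      rw [stateShape_zero] at h
      obtain ⟨ex, ey, eu, ew, hex, hey, heu, hew, hS⟩ := h
      have h' := shape1_of_shape0 hd hd2 hex hey heu hew hS
      rw [chartAt_zero, stateShape_one]
      exact ⟨ex + ey + eu + ew + dOf m - 8, ew, by omega, by omega, hew, h'⟩
    · -- blow-up (2)
      rw [stateShape_one] at h
      obtain ⟨ex, ew, hex, hex8, hew, hS⟩ := h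
      have h' := shape2_of_shape1 hd hd2 hex hex8 hew hS
      rw [chartAt_one, stateShape_two]
      exact ⟨ex + ew + dOf m - 4, ew, by omega, hew, h'⟩
    · -- blow-up (3)
      rw [stateShape_two] at h
      obtain ⟨ex, ew, hex, hew, hS⟩ := h
      have h' := shape4_of_shape2 hd hd2 hex hew hS
      rw [chartAt_two, stateShape_four le_rfl (by omega)]
      exact ⟨ex, ex + ew + dOf m - 5, 0, ew, hex, by omega, by omega, hew, h'⟩
  rcases Nat.lt_or_ge i (m + 4) with h4 | h4
  · -- blow-ups (4)
    rw [stateShape_four h3 (by omega)] at h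
    obtain ⟨ex, eu, ev, ew, hex, heu, hev, hew, hS⟩ := h
    have h' := shape4_succ hd hd2 hex heu hew hS
    rw [chartAt_four h3 (by omega), stateShape_four (by omega) (by omega),
      show i + 1 - 3 = (i - 3) + 1 by omega]
    exact ⟨ex, eu, ev + (ex + eu + ew + dOf m - 5), ew, hex, heu, by omega, hew, h'⟩
  rcases Nat.lt_or_ge i (m + 5) with h5 | h5
  · -- blow-up (5)
    have hi : i = m + 4 := by omega
    subst hi
    rw [stateShape_four h3 le_rfl] at h
    obtain ⟨ex, eu, ev, ew, hex, heu, hev, hew, hS⟩ := h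
    have h' := shape5_of_shape4 (c := m + 4 - 3) (by unfold dOf; omega) hd hex heu hew hS
    rw [chartAt_five, stateShape_five]
    refine ⟨ex, eu, ex + eu + ev + ew + dOf m - 5, hex, heu, ?_, h'⟩
    simp only [dOf] at *
    omega
  rcases Nat.lt_or_ge i (m + 6) with h6 | h6
  · -- blow-up (6)
    have hi : i = m + 5 := by omega
    subst hi
    rw [stateShape_five] at h
    obtain ⟨ex, eu, ew, hex, heu, hew, hS⟩ := h
    have h' := shape7_of_shape5 hd hd2 hex heu hew hS
    rw [chartAt_six, stateShape_seven le_rfl, show m + 5 + 1 - (m + 6) = 0 by omega]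
    exact ⟨ex, 0, ex + eu + ew + dOf m - 5, ew, hex, by omega, by omega, hew, h'⟩
  · -- blow-ups (7)
    rw [stateShape_seven h6] at h
    obtain ⟨ex, ey, eu, ew, hex, hey, heu, hew, hS⟩ := h
    have h' := shape7_succ hd hd2 hex hey heu hew hS
    rw [chartAt_seven h6, stateShape_seven (by omega), show i + 1 - (m + 6) = (i - (m + 6)) + 1 by omega]
    exact ⟨ex, ey + (ex + eu + ew + dOf m - 6), eu, ew, hex, by omega, heu, hew, h'⟩

/-- **The last blow-up of a cycle** yields the starting state of the next cycle, with `y ↔ u`.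
[cite: HauserPerlega2019, §4 First example (7)] -/
theorem stateShape_wrap [CharP K 2] {m : ℕ} {G : MvPolynomial (Fin 5) K}
    (h : StateShape m (len m - 1) G) :
    StateShape (m + 1) 0 (rename (Equiv.swap (1 : Fin 5) 2)
      (blowupStep 8 (chartAt m (len m - 1)).1 (tOf (chartAt m (len m - 1)).2) G)) := by
  have hd : 2 ≤ dOf m := by unfold dOf; omega
  have hd2 : dOf m % 2 = 0 := by unfold dOf; omega
  have h6 : m + 6 ≤ len m - 1 := by unfold len; omega
  rw [stateShape_seven h6] at h
  obtain ⟨ex, ey, eu, ew, hex, hey, heu, hew, hS⟩ := h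
  have h' := shape7_succ hd hd2 hex hey heu hew hS
  rw [show len m - 1 - (m + 6) + 1 = 2 * dOf m + 10 by unfold len dOf; omega] at h'
  have h'' := shape0_rename_of_shape7 h'
  rw [chartAt_seven h6, stateShape_zero, show dOf (m + 1) = dOf m + 2 by unfold dOf; omega]
  refine ⟨ex, eu, ey + (ex + eu + ew + dOf m - 6), ew, hex, heu, by omega, by omega, h''⟩

/-! ## The invariant along the sequence -/

/-- The position index stays below the cycle length. [folklore] -/
theorem pos_snd_lt (k : ℕ) : (pos k).2 < len (pos k).1 := by
  induction k with
  | zero => simp [pos, len]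
  | succ k ih =>
    rw [pos_succ]
    split_ifs with h
    · exact h
    · simp [len]

/-- In the roles of cycle `0`, the `(k+1)`-st polynomial is the blow-up step of the `k`-th.
[folklore] -/
theorem rename_seq_succ (k : ℕ) :
    rename (sw (pos k).1) (seq K (k + 1)) =
      blowupStep 8 (chartAt (pos k).1 (pos k).2).1 (tOf (chartAt (pos k).1 (pos k).2).2)
        (rename (sw (pos k).1) (seq K k)) := by
  rw [seq, seqF_succ, rename_blowupStep, jSched, tSched, Equiv.apply_symm_apply]
  congr 1
  funext i
  simp

/-- **The invariant**: after `k` blow-ups, at position `(m, i)`, the polynomial (read in the roles of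
cycle `0`, i.e. after undoing the accumulated exchanges of `y` and `u`) has the state shape `(m, i)`.
[cite: HauserPerlega2019, §4 First example] -/
theorem stateShape_seq [CharP K 2] [Nontrivial K] (k : ℕ) :
    StateShape (pos k).1 (pos k).2 (rename (sw (pos k).1) (seq K k)) := by
  induction k with
  | zero =>
    rw [show pos 0 = (0, 0) from rfl, stateShape_zero]
    simp only [sw, pow_zero, Equiv.Perm.coe_one, rename_id_apply, seq, seqF_zero]
    exact ⟨4, 4, 0, 6, rfl, rfl, rfl, by decide, shape0_F0⟩
  | succ k ih =>
    have hlt := pos_snd_lt k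
    rw [pos_succ]
    split_ifs with h
    · rw [rename_seq_succ]
      exact stateShape_step h ih
    · have hi : (pos k).2 = len (pos k).1 - 1 := by omega
      rw [sw_succ, Equiv.Perm.coe_mul, ← rename_rename, rename_seq_succ]
      rw [hi] at ih ⊢
      exact stateShape_wrap ih

/-! ## Orders and residual orders from the state -/

/-- Every state shape forces `ord F ≥ 8` and residual order `≥ d`, for every exceptional set.
[cite: HauserPerlega2019, §4 First example] -/
theorem bounds_of_stateShape {m i : ℕ} {G : MvPolynomial (Fin 5) K} (h : StateShape m i G) :
    (∀ e ∈ G.support, 8 ≤ e.degree) ∧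
      ∃ mv : Fin 5 → ℕ, (∀ l, ∃ e ∈ G.support, e l ≤ mv l) ∧
        ∀ e ∈ G.support, dOf m + ∑ l, mv l ≤ e.degree := by
  have hd : 2 ≤ dOf m := by unfold dOf; omega
  unfold StateShape at h
  split_ifs at h with h0 h1 h2 h4 h5
  · obtain ⟨ex, ey, eu, ew, hex, hey, heu, hew, hR, hk1, hk2⟩ := h
    refine ⟨fun e he => ?_, ![ex, ey, eu, 0, ew], ?_, fun e he => ?_⟩
    · have := hR e he; rw [eq_V_iff] at this; rw [degree_fin5]; omega
    · rw [forall_fin5]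
      refine ⟨⟨_, mem_support_iff.mpr hk1, ?_⟩, ⟨_, mem_support_iff.mpr hk1, ?_⟩,
        ⟨_, mem_support_iff.mpr hk1, ?_⟩, ⟨_, mem_support_iff.mpr hk1, ?_⟩,
        ⟨_, mem_support_iff.mpr hk2, ?_⟩⟩ <;> simp
    · have := hR e he; rw [eq_V_iff] at this; rw [degree_fin5, Fin.sum_univ_five]
      simp only [Matrix.cons_val_zero, Matrix.cons_val_one, Matrix.cons_val]
      omega
  · obtain ⟨ex, ew, hex, hex8, hew, hR, hk1, hk2⟩ := h
    refine ⟨fun e he => ?_, ![ex, 0, 0, 0, ew], ?_, fun e he => ?_⟩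
    · have := hR e he; rw [degree_fin5]; omega
    · rw [forall_fin5]
      refine ⟨⟨_, mem_support_iff.mpr hk1, ?_⟩, ⟨_, mem_support_iff.mpr hk2, ?_⟩,
        ⟨_, mem_support_iff.mpr hk1, ?_⟩, ⟨_, mem_support_iff.mpr hk1, ?_⟩,
        ⟨_, mem_support_iff.mpr hk2, ?_⟩⟩ <;> simp
    · have := hR e he; rw [degree_fin5, Fin.sum_univ_five]
      simp only [Matrix.cons_val_zero, Matrix.cons_val_one, Matrix.cons_val]
      omega
  · obtain ⟨ex, ew, hex, hew, hR, hk1, hk2⟩ := h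
    refine ⟨fun e he => ?_, ![ex, 0, 0, 0, ew], ?_, fun e he => ?_⟩
    · have := hR e he; rw [degree_fin5]; omega
    · rw [forall_fin5]
      refine ⟨⟨_, mem_support_iff.mpr hk1, ?_⟩, ⟨_, mem_support_iff.mpr hk2, ?_⟩,
        ⟨_, mem_support_iff.mpr hk1, ?_⟩, ⟨_, mem_support_iff.mpr hk1, ?_⟩,
        ⟨_, mem_support_iff.mpr hk2, ?_⟩⟩ <;> simp
    · have := hR e he; rw [degree_fin5, Fin.sum_univ_five]
      simp only [Matrix.cons_val_zero, Matrix.cons_val_one, Matrix.cons_val]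
      omega
  · obtain ⟨ex, eu, ev, ew, hex, heu, hev, hew, hR, hk1, hk2⟩ := h
    refine ⟨fun e he => ?_, ![ex, 0, eu, ev, ew], ?_, fun e he => ?_⟩
    · have := hR e he; rw [degree_fin5]; omega
    · rw [forall_fin5]
      refine ⟨⟨_, mem_support_iff.mpr hk1, ?_⟩, ⟨_, mem_support_iff.mpr hk2, ?_⟩,
        ⟨_, mem_support_iff.mpr hk2, ?_⟩, ⟨_, mem_support_iff.mpr hk2, ?_⟩,
        ⟨_, mem_support_iff.mpr hk2, ?_⟩⟩ <;> simp
    · have := hR e he; rw [degree_fin5, Fin.sum_univ_five]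
      simp only [Matrix.cons_val_zero, Matrix.cons_val_one, Matrix.cons_val]
      omega
  · obtain ⟨ex, eu, ew, hex, heu, hew, hR, hk1, hk2⟩ := h
    refine ⟨fun e he => ?_, ![ex, 0, eu, 0, ew], ?_, fun e he => ?_⟩
    · have := hR e he; rw [degree_fin5]; omega
    · rw [forall_fin5]
      refine ⟨⟨_, mem_support_iff.mpr hk1, ?_⟩, ⟨_, mem_support_iff.mpr hk2, ?_⟩,
        ⟨_, mem_support_iff.mpr hk2, ?_⟩, ⟨_, mem_support_iff.mpr hk2, ?_⟩,
        ⟨_, mem_support_iff.mpr hk2, ?_⟩⟩ <;> simp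
    · have := hR e he; rw [degree_fin5, Fin.sum_univ_five]
      simp only [Matrix.cons_val_zero, Matrix.cons_val_one, Matrix.cons_val]
      omega
  · obtain ⟨ex, ey, eu, ew, hex, hey, heu, hew, hR, hk1, hk2⟩ := h
    refine ⟨fun e he => ?_, ![ex, ey, eu, 0, ew], ?_, fun e he => ?_⟩
    · have := hR e he; rw [eq_V_iff] at this; rw [degree_fin5]; omega
    · rw [forall_fin5]
      refine ⟨⟨_, mem_support_iff.mpr hk1, ?_⟩, ⟨_, mem_support_iff.mpr hk1, ?_⟩,
        ⟨_, mem_support_iff.mpr hk1, ?_⟩, ⟨_, mem_support_iff.mpr hk1, ?_⟩,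
        ⟨_, mem_support_iff.mpr hk2, ?_⟩⟩ <;> simp
    · have := hR e he; rw [eq_V_iff] at this; rw [degree_fin5, Fin.sum_univ_five]
      simp only [Matrix.cons_val_zero, Matrix.cons_val_one, Matrix.cons_val]
      omega

/-- `rename` by `sw m` is undone by `rename` by its inverse. [folklore] -/
theorem rename_symm_rename (s : Equiv.Perm (Fin 5)) (G : MvPolynomial (Fin 5) K) :
    rename s.symm (rename s G) = G := by
  rw [rename_rename, Equiv.symm_comp_self, rename_id_apply]

/-- **Along the whole sequence `ord F^k ≥ 8`**: the order of `f = z⁸ + F^k` stays `8`.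
[cite: HauserPerlega2019, §4 First example] -/
theorem le_ordZero_seq [CharP K 2] [Nontrivial K] (k : ℕ) : (8 : ℕ∞) ≤ ordZero (seq K k) := by
  obtain ⟨hdeg, -⟩ := bounds_of_stateShape (stateShape_seq (K := K) k)
  have h := degree_bound_rename (sw (pos k).1).symm _ 8 hdeg
  rw [rename_symm_rename] at h
  exact_mod_cast le_ordZero_of_forall_mem_support h

/-- **The residual order after `k` blow-ups is at least `d = 2m + 2`**, `m` the current cycle, for
every exceptional set. [cite: HauserPerlega2019, §4 First example] -/
theorem le_residualOrder_seq [CharP K 2] [Nontrivial K] (k : ℕ) (Δ : Finset (Fin 5)) :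
    (dOf (pos k).1 : ℕ∞) ≤ residualOrder Δ (seq K k) := by
  obtain ⟨-, mv, hm, hN⟩ := bounds_of_stateShape (stateShape_seq (K := K) k)
  obtain ⟨hm', hN'⟩ := residualBound_rename (sw (pos k).1).symm hm hN
  rw [rename_symm_rename] at hm' hN'
  exact le_residualOrder Δ _ _ hm' hN'

/-! ## The cycle index tends to infinity -/

/-- Index of the first blow-up of cycle `M`. [folklore] -/
def kStart : ℕ → ℕ
  | 0 => 0
  | M + 1 => kStart M + len M

/-- Inside a cycle the position index counts up. [folklore] -/
theorem pos_add_of_pos_eq {k m : ℕ} (hk : pos k = (m, 0)) : ∀ i, i < len m → pos (k + i) = (m, i) := by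
  intro i
  induction i with
  | zero => intro _; simpa using hk
  | succ i ih =>
    intro hi
    rw [← add_assoc, pos_succ, ih (by omega)]
    simp [hi]

/-- Cycles are non-empty. [folklore] -/
theorem one_le_len (M : ℕ) : 1 ≤ len M := by unfold len; omega

/-- Cycle `M` starts at blow-up number `kStart M`. [folklore] -/
theorem pos_kStart (M : ℕ) : pos (kStart M) = (M, 0) := by
  induction M with
  | zero => rfl
  | succ M ih =>
    have hl := one_le_len M
    have h := pos_add_of_pos_eq ih (len M - 1) (by omega)
    have heq : kStart (M + 1) = kStart M + (len M - 1) + 1 := by rw [kStart]; omega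
    rw [heq, pos_succ, h]
    simp only [show ¬ (len M - 1 + 1 < len M) by omega, if_false]

/-- The cycle index never decreases. [folklore] -/
theorem pos_fst_mono (k : ℕ) : ∀ n, (pos k).1 ≤ (pos (k + n)).1 := by
  intro n
  induction n with
  | zero => simp
  | succ n ih =>
    rw [← add_assoc, pos_succ]
    split_ifs
    · exact ih
    · exact ih.trans (Nat.le_succ _)

/-- After `kStart M` blow-ups we are in cycle `≥ M`. [folklore] -/
theorem le_pos_fst {M k : ℕ} (hk : kStart M ≤ k) : M ≤ (pos k).1 := by
  obtain ⟨n, rfl⟩ := Nat.exists_eq_add_of_le hk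
  have := pos_fst_mono (kStart M) n
  rw [pos_kStart] at this
  exact this

end Example1

/-- **Hauser–Perlega's first example, assembled**: over every field of characteristic `2` there
is a point blow-up sequence with `pᵉ = 8`, `n = 5`, starting from `F⁰ = x⁴y⁴w⁶(w² + x³u¹⁰)`
(residual order `2`), along which `ord f` stays `8` and the residual order tends to infinity
(it is `≥ 2m + 2` throughout cycle `m`). This is the first conjunct of `HauserPerlega2019`
(which asks it only for algebraically closed fields). [cite: HauserPerlega2019, §1 and §4 First example] -/
theorem hasDivergentPointBlowupSequence_two (K : Type) [Field K] [CharP K 2] :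
    HasDivergentPointBlowupSequence 2 3 5 K := by
  refine ⟨Example1.seq K, seqΔ Finset.univ Example1.jSched (Example1.tSched K), Example1.jSched,
    Example1.tSched K, ?_, ?_, ?_⟩
  · rw [show (2 : ℕ) ^ 3 = 8 by norm_num]
    exact isPointBlowupSequence_seq _ Example1.isClean_F0 Example1.le_ordZero_seq
  · exact exists_nat_eq_residualOrder _ Example1.F0_ne_zero
  · intro N
    refine ⟨Example1.kStart N, fun k hk => ?_⟩
    have h1 := Example1.le_residualOrder_seq (K := K) k
      (seqΔ Finset.univ Example1.jSched (Example1.tSched K) k)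
    have h2 := Example1.le_pos_fst hk
    refine lt_of_lt_of_le ?_ h1
    have : N < Example1.dOf (Example1.pos k).1 := by unfold Example1.dOf; omega
    exact_mod_cast this

end HauserPerlega

end Literature.Barriers.ResolutionOfSingularities
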